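/-
Copyright (c) 2026. All rights reserved.
Released under Apache 2.0 license as described in the file LICENSE.
-/
import Literature.NumberTheory.Weil1964.AdelicCompactFamilyDominated
import HarnessLib

/-!
# Weil's Lemme 5 is stable under conjugation by a fixed metaplectic element — the decay data

Topic `NumberTheory/Weil1964`; namespace `Literature.NumberTheory.Weil1964`.  KERNEL mathematics only (theorems; no
definition, no named fact, no `axiom`, no proof hole).

[Weil1964, Chap. III n° 41, Lemme 5 p. 194] is proved in the tree along a continuous homomorphism
`s : H → Mp_ψ(W_𝔸)ᶜᵒⁿᵗ` with an archimedean covariant family (★ `AdelicMetaplecticThetaMajorants.decay_near`).  A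
consumer reading the same group in ANOTHER POLARISATION (the Siegel–Weil ∕ Rallis engine reads the `W□`-member of the
doubled unitary dual pair conjugated by a lift `q` of Li's rational `δ♮`) needs the family `ω(q) · {ω(s h)Φ♭}`.  Bare
domination does not pass through the fixed operator `ω(q)` (a partial Fourier transform) and left multiplication by
`q` is not continuous for the weak topology of `Mp_ψ(W_𝔸)ᶜᵒⁿᵗ`; this file transports the DECAY DATA instead, reusing
the PUBLIC steps of ★ `decay_near`: near `h = 1`, on the generators,
`ω(s h)(Ψ ⊗ ρ_f(v̂_a)𝟙_L) = (κ_h W_∞(h)Ψ) ⊗ ρ_f(π(s h)v̂_a)𝟙_L`, `|κ_h| ≤ K` (★ `eventually_exists_generator_factor`,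
★ `exists_bound_generator_factor`); `ω(q)(Ψ′ ⊗ φ) = (c · W_q Ψ′) ⊗ B_q φ` with `B_q` a finite implementer of `π(q)`
(★ `exists_factors_of_archModTrans_covariant`, `B_q ρ_f(η) = ρ_f(π(q)η) B_q` ★ `comp_finSchrodinger_of_finImplementer`);
hence `ω(q)ω(s h)(generator) = (c κ_h · W_q W_∞(h) Ψ) ⊗ ρ_f(π(q)π(s h)v̂_a)(B_q 𝟙_L)` — a CONTINUOUS archimedean family
(★ `IsArchFactor.of_continuous`) times a modulated translate of the FIXED `B_q 𝟙_L`, bounded and supported in one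
compact set for `h` near `1` (only the orbit maps of `π ∘ s` enter).

Main statements: `decay_generator_conj`, `decay_near_one_conj`, `decay_near_conj` — locally uniform decay of every
order for `h ↦ ω(q)ω(s h)Φ`, given an archimedean operator `W_q` covariant over `π(q)`.  The pointwise Lemme 5 for
`h ↦ q · s(h) · q⁻¹` (where `W_q` is produced from ★ `exists_MpS_over_archPhaseMap`) is the sequel
`AdelicCompactFamilyDominatedConj`.  Cell hodgecm-mathlib FLOOR 0, engine E-2 (crux item H413), input (DOM-C) in the
δ♮-frame.  HC_CM is proved only modulo the printed citations until rung 0 closes; nothing here is about Hodge classes.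

## References
* [Weil1964] A. Weil, *Sur certains groupes d'opérateurs unitaires*, Acta Math. 111 (1964) 143–211, Chap. III n° 39
  p. 189, n° 41 Lemme 5 p. 194.
* [MoeglinVignerasWaldspurger1987] C. Mœglin, M.-F. Vignéras, J.-L. Waldspurger, LNM 1291 (1987), Chap. 2 II.1.
* [Folland1989] G. B. Folland, *Harmonic Analysis in Phase Space* (1989), Prop. (1.43), §4.2 (4.23).
-/

set_option autoImplicit false

noncomputable section

open scoped Matrix SchwartzMap TensorProduct Topology Classical

open NumberField NumberField.mixedEmbedding IsDedekindDomain Set Filter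

namespace Literature.NumberTheory.Weil1964

open Literature.NumberTheory.Automorphic Literature.RepresentationTheory.HeisenbergGroup
open Literature.Analysis.SegalBargmann

section Decay

variable {F : Type} [Field F] [NumberField F] {n : ℕ} {T : Matrix (Fin n) (Fin n) (AdeleRing (𝓞 F) F)}
  {H : Type*} [Group H] [TopologicalSpace H] [IsTopologicalGroup H]
  (hT : IsUnit T) (s : H → adelicMpCont F (Fin n) T) (hsm : ∀ a b : H, s (a * b) = s a * s b)
  (hs : Continuous s)
  (Winf : H → (𝓢((Fin n → mixedSpace F), ℂ) →L[ℂ] 𝓢((Fin n → mixedSpace F), ℂ)))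
  (w0 : ∀ h, Winf h ≠ 0) (w1 : ∀ Φ, Continuous fun h => Winf h Φ)
  (w2 : ∀ (h : H) (a w : Fin n → mixedSpace F) (Φ : 𝓢((Fin n → mixedSpace F), ℂ)),
    Winf h (archModTrans F (Fin n) T a w Φ) =
      weilPhase T (adelicMpCont.proj F (Fin n) T (s h)) (a, w) •
        archModTrans F (Fin n) T (archAct T (adelicMpCont.proj F (Fin n) T (s h)) (a, w)).1
          (archAct T (adelicMpCont.proj F (Fin n) T (s h)) (a, w)).2 (Winf h Φ))
  (q : adelicMpCont F (Fin n) T)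
  (Wq : 𝓢((Fin n → mixedSpace F), ℂ) →L[ℂ] 𝓢((Fin n → mixedSpace F), ℂ)) (hWq0 : Wq ≠ 0)
  (hWq : ∀ (a w : Fin n → mixedSpace F) (Φ : 𝓢((Fin n → mixedSpace F), ℂ)),
    Wq (archModTrans F (Fin n) T a w Φ) =
      weilPhase T (adelicMpCont.proj F (Fin n) T q) (a, w) •
        archModTrans F (Fin n) T (archAct T (adelicMpCont.proj F (Fin n) T q) (a, w)).1
          (archAct T (adelicMpCont.proj F (Fin n) T q) (a, w)).2 (Wq Φ))

/-- a fixed symplectic automorphism of `W_𝔸` is continuous (orbit maps of a constant family). [folklore] -/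
private theorem continuous_symplectic_apply (g : symplecticGroup (polar (adelicForm F (Fin n) T))) :
    Continuous fun w : (Fin n → AdeleRing (𝓞 F) F) × (Fin n → AdeleRing (𝓞 F) F) =>
      ((g : symplecticGroup (polar (adelicForm F (Fin n) T))) :
        ((Fin n → AdeleRing (𝓞 F) F) × (Fin n → AdeleRing (𝓞 F) F)) ≃ₗ[AdeleRing (𝓞 F) F]
          ((Fin n → AdeleRing (𝓞 F) F) × (Fin n → AdeleRing (𝓞 F) F))) w :=
  (continuous_symplectic_apply₂ (g := fun _ : Unit => g) (fun _ => continuous_const)).comp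
    ((continuous_const (y := ())).prodMk continuous_id)

/-- a Schwartz–Bruhat function on `(𝔸_F^∞)ⁿ` is bounded. [folklore] -/
private theorem exists_bound_finSB (f : FinSB F (Fin n)) :
    ∃ C : ℝ, 0 ≤ C ∧ ∀ b, ‖(f : (Fin n → FiniteAdeleRing (𝓞 F) F) → ℂ) b‖ ≤ C := by
  obtain ⟨hlc, hcs⟩ := (mem_schwartzBruhat_iff).1 f.2
  obtain ⟨C, hC⟩ := hlc.continuous.bounded_above_of_compact_support hcs
  exact ⟨max C 0, le_max_right _ _, fun b => (hC b).trans (le_max_left _ _)⟩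

/-- **Value and support of a tensor `Ψ' ⊗ ρ_f(η') f₀`**: `|Φ(x)| ≤ |Ψ'(x_∞)| · sup|f₀|`, and `Φ(x) = 0` unless
`(η'_1)_f + x_f` lies in the support of `f₀`. [folklore] -/
private theorem value_bounds_tmul (Ψ' : 𝓢((Fin n → mixedSpace F), ℂ)) (η' : AdelicHeisenberg F (Fin n) T)
    (f₀ : FinSB F (Fin n)) {Cb : ℝ} (hCb : ∀ b, ‖(f₀ : (Fin n → FiniteAdeleRing (𝓞 F) F) → ℂ) b‖ ≤ Cb)
    {Φ : piSchwartzBruhat F (Fin n)}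
    (hΦ : Φ = piSchwartzBruhatEquiv F (Fin n) (Ψ' ⊗ₜ[ℂ] finSchrodinger T η' f₀)) (x : Fin n → AdeleRing (𝓞 F) F) :
    ‖(Φ : (Fin n → AdeleRing (𝓞 F) F) → ℂ) x‖ ≤ ‖Ψ' (piArch F (Fin n) x)‖ * Cb ∧
      (piFinite F (Fin n) η'.v.1 + piFinite F (Fin n) x ∉
          tsupport ((f₀ : FinSB F (Fin n)) : (Fin n → FiniteAdeleRing (𝓞 F) F) → ℂ) →
        (Φ : (Fin n → AdeleRing (𝓞 F) F) → ℂ) x = 0) := by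
  subst hΦ
  rw [coe_piSchwartzBruhatEquiv_tmul]
  beta_reduce
  refine ⟨?_, fun hb => ?_⟩
  · rw [norm_mul]
    refine mul_le_mul_of_nonneg_left ?_ (norm_nonneg _)
    rw [coe_finSchrodinger_apply, norm_mul, norm_mul, Circle.norm_coe, Circle.norm_coe, one_mul, one_mul]
    exact hCb _
  · rw [coe_finSchrodinger_apply, image_eq_zero_of_notMem_tsupport hb, mul_zero, mul_zero, mul_zero]

set_option maxHeartbeats 800000 in
include hT hsm hs w0 w1 w2 hWq0 hWq in
/-- **Locally uniform decay of `ω(q)ω(s h)` on the generators near `1`** (`Φ = Ψ ⊗ ρ_f(v̂_a)𝟙_L`, i.e. `Ψ ⊗ T_a 𝟙_L`):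
`ω(q)ω(s h)(Ψ ⊗ T_a 𝟙_L) = (c κ_h · W_q W_∞(h)Ψ) ⊗ ρ_f(π(q)π(s h)v̂_a)(B_q 𝟙_L)` with `|κ_h| ≤ K`
(★ `eventually_exists_generator_factor`, ★ `exists_bound_generator_factor`, ★ `exists_factors_of_archModTrans_covariant`),
`W_q W_∞(h)Ψ` uniformly rapidly decreasing (★ `IsArchFactor.of_continuous`), and the finite part a modulated translate
of the fixed `B_q 𝟙_L` — bounded, supported in one compact set for `h` near `1`.
[cite: Weil1964, Chap. III n° 41, Lemme 5 p. 194] [cite: MoeglinVignerasWaldspurger1987, Chap. 2 II.1] -/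
theorem decay_generator_conj (L : AddSubgroup (Fin n → FiniteAdeleRing (𝓞 F) F))
    (hLo : IsOpen (L : Set (Fin n → FiniteAdeleRing (𝓞 F) F)))
    (hLc : IsCompact (L : Set (Fin n → FiniteAdeleRing (𝓞 F) F))) (Ψ : 𝓢((Fin n → mixedSpace F), ℂ))
    (a : Fin n → FiniteAdeleRing (𝓞 F) F) (k : ℕ) :
    ∃ V ∈ 𝓝 (1 : H), ∃ (M : ℝ) (Cf : Set (Fin n → FiniteAdeleRing (𝓞 F) F)), 0 ≤ M ∧ IsCompact Cf ∧
      ∀ g ∈ V,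
        (∀ x, ‖((adelicMpCont.omega F (Fin n) T q (adelicMpCont.omega F (Fin n) T (s g)
          (piSchwartzBruhatEquiv F (Fin n)
            (Ψ ⊗ₜ[ℂ] finTranslateSB F (Fin n) a (indicatorSB F (Fin n) L hLo hLc)))) :
            piSchwartzBruhat F (Fin n)) : (Fin n → AdeleRing (𝓞 F) F) → ℂ) x‖ ≤
            M * (1 + ‖vecInfinitePart F n x‖) ^ (-(k : ℝ))) ∧
        (∀ x, vecFinitePart F n x ∉ Cf →
            ((adelicMpCont.omega F (Fin n) T q (adelicMpCont.omega F (Fin n) T (s g)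
              (piSchwartzBruhatEquiv F (Fin n)
                (Ψ ⊗ₜ[ℂ] finTranslateSB F (Fin n) a (indicatorSB F (Fin n) L hLo hLc)))) :
              piSchwartzBruhat F (Fin n)) : (Fin n → AdeleRing (𝓞 F) F) → ℂ) x = 0) := by
  -- the generator as `Ψ ⊗ ρ_f(v̂_a) 𝟙_L`, `v_a = ((0, a), 0)`
  have hexv : ∃ va : (Fin n → AdeleRing (𝓞 F) F) × (Fin n → AdeleRing (𝓞 F) F),
      va = (piAdeleSplit F (Fin n) (0, a), 0) := ⟨_, rfl⟩
  rcases hexv with ⟨va, hva⟩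
  have hηa : Heisenberg.ofVec (polar (adelicForm F (Fin n) T)) va ∈ finHeisenberg T := by
    rw [hva]
    exact ofVec_mem_finHeisenberg (finIdem_smul_piAdeleSplit_zero a) (smul_zero _)
  have hgen : finTranslateSB F (Fin n) a (indicatorSB F (Fin n) L hLo hLc) =
      finSchrodinger T (Heisenberg.ofVec (polar (adelicForm F (Fin n) T)) va)
        (indicatorSB F (Fin n) L hLo hLc) := by
    rw [hva, finSchrodinger_ofVec_inl]
  -- the tensor form of `ω(q)`: `ω(q)(Ψ' ⊗ φ) = (c W_q Ψ') ⊗ B φ`, `B` a finite implementer of `π(q)`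
  have hexB := exists_factors_of_archModTrans_covariant hT q Wq hWq0 hWq
  rcases hexB with ⟨c, B, -, hB, hfac⟩
  -- the fixed finite function `f₀ = B 𝟙_L`: bounded, compactly supported
  have hexf : ∃ f₀ : FinSB F (Fin n), f₀ = B (indicatorSB F (Fin n) L hLo hLc) := ⟨_, rfl⟩
  rcases hexf with ⟨f₀, hf₀⟩
  have hexC := exists_bound_finSB f₀
  rcases hexC with ⟨Cb, hCb0, hCb⟩
  have hcs : HasCompactSupport ((f₀ : FinSB F (Fin n)) : (Fin n → FiniteAdeleRing (𝓞 F) F) → ℂ) :=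
    ((mem_schwartzBruhat_iff).1 f₀.2).2
  -- the neighbourhoods: factorisation with ONE scalar, bound on the scalar, archimedean decay, position
  have hK := exists_bound_generator_factor s hs Winf w0 w1 L hLo hLc
  rcases hK with ⟨K, hK0, evK⟩
  have evF := eventually_exists_generator_factor hT s hsm hs Winf w0 w2 L hLo hLc
  have hexa := (IsArchFactor.of_continuous (A := fun h Φ => Wq (Winf h Φ))
    (fun Φ => Wq.continuous.comp (w1 Φ))).decay Ψ k 1
  rcases hexa with ⟨Va, hVa, S, hS0, hS⟩
  -- the finite position `c(g) = ((π(q) π(s g) v_a)_1)_f`, continuous in `g`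
  have hπq := continuous_symplectic_apply (adelicMpCont.proj F (Fin n) T q)
  have hcc : Continuous fun g : H => piFinite F (Fin n)
      (((adelicMpCont.proj F (Fin n) T q : symplecticGroup (polar (adelicForm F (Fin n) T))) :
        ((Fin n → AdeleRing (𝓞 F) F) × (Fin n → AdeleRing (𝓞 F) F)) ≃ₗ[AdeleRing (𝓞 F) F]
          ((Fin n → AdeleRing (𝓞 F) F) × (Fin n → AdeleRing (𝓞 F) F)))
        (((adelicMpCont.proj F (Fin n) T (s g) : symplecticGroup (polar (adelicForm F (Fin n) T))) :
          ((Fin n → AdeleRing (𝓞 F) F) × (Fin n → AdeleRing (𝓞 F) F)) ≃ₗ[AdeleRing (𝓞 F) F]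
            ((Fin n → AdeleRing (𝓞 F) F) × (Fin n → AdeleRing (𝓞 F) F))) va)).1 :=
    continuous_piFinite.comp (continuous_fst.comp (hπq.comp ((adelicMpCont.continuous_proj_apply va).comp hs)))
  -- reference position at `g = 1` and a compact open box around it
  have hexc₀ : ∃ c₀ : Fin n → FiniteAdeleRing (𝓞 F) F, c₀ = piFinite F (Fin n)
      (((adelicMpCont.proj F (Fin n) T q : symplecticGroup (polar (adelicForm F (Fin n) T))) :
        ((Fin n → AdeleRing (𝓞 F) F) × (Fin n → AdeleRing (𝓞 F) F)) ≃ₗ[AdeleRing (𝓞 F) F]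
          ((Fin n → AdeleRing (𝓞 F) F) × (Fin n → AdeleRing (𝓞 F) F)))
        (((adelicMpCont.proj F (Fin n) T (s 1) : symplecticGroup (polar (adelicForm F (Fin n) T))) :
          ((Fin n → AdeleRing (𝓞 F) F) × (Fin n → AdeleRing (𝓞 F) F)) ≃ₗ[AdeleRing (𝓞 F) F]
            ((Fin n → AdeleRing (𝓞 F) F) × (Fin n → AdeleRing (𝓞 F) F))) va)).1 := ⟨_, rfl⟩
  rcases hexc₀ with ⟨c₀, hc₀⟩
  have h10 : -c₀ + piFinite F (Fin n)
      (((adelicMpCont.proj F (Fin n) T q : symplecticGroup (polar (adelicForm F (Fin n) T))) :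
        ((Fin n → AdeleRing (𝓞 F) F) × (Fin n → AdeleRing (𝓞 F) F)) ≃ₗ[AdeleRing (𝓞 F) F]
          ((Fin n → AdeleRing (𝓞 F) F) × (Fin n → AdeleRing (𝓞 F) F)))
        (((adelicMpCont.proj F (Fin n) T (s 1) : symplecticGroup (polar (adelicForm F (Fin n) T))) :
          ((Fin n → AdeleRing (𝓞 F) F) × (Fin n → AdeleRing (𝓞 F) F)) ≃ₗ[AdeleRing (𝓞 F) F]
            ((Fin n → AdeleRing (𝓞 F) F) × (Fin n → AdeleRing (𝓞 F) F))) va)).1 ∈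
      (piLevelIdeal F (Fin n) ⊤ : Set (Fin n → FiniteAdeleRing (𝓞 F) F)) := by
    rw [← hc₀, neg_add_cancel]
    exact (piLevelIdeal F (Fin n) ⊤).zero_mem
  have hVp : ∀ᶠ g in 𝓝 (1 : H), -c₀ + piFinite F (Fin n)
      (((adelicMpCont.proj F (Fin n) T q : symplecticGroup (polar (adelicForm F (Fin n) T))) :
        ((Fin n → AdeleRing (𝓞 F) F) × (Fin n → AdeleRing (𝓞 F) F)) ≃ₗ[AdeleRing (𝓞 F) F]
          ((Fin n → AdeleRing (𝓞 F) F) × (Fin n → AdeleRing (𝓞 F) F)))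
        (((adelicMpCont.proj F (Fin n) T (s g) : symplecticGroup (polar (adelicForm F (Fin n) T))) :
          ((Fin n → AdeleRing (𝓞 F) F) × (Fin n → AdeleRing (𝓞 F) F)) ≃ₗ[AdeleRing (𝓞 F) F]
            ((Fin n → AdeleRing (𝓞 F) F) × (Fin n → AdeleRing (𝓞 F) F))) va)).1 ∈
      (piLevelIdeal F (Fin n) ⊤ : Set (Fin n → FiniteAdeleRing (𝓞 F) F)) :=
    (continuous_const.add hcc).continuousAt.eventually_mem ((isOpen_piLevelIdeal F ⊤).mem_nhds h10)
  -- the compact set of finite positions: `x_f ∈ -(c₀ + l) + t`, `l ∈ L_⊤`, `t ∈ tsupport f₀`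
  refine ⟨_, inter_mem (evF.and evK) (inter_mem hVa hVp), ‖c‖ * K * S * Cb,
    (fun p : (Fin n → FiniteAdeleRing (𝓞 F) F) × (Fin n → FiniteAdeleRing (𝓞 F) F) => -(c₀ + p.1) + p.2) ''
      ((piLevelIdeal F (Fin n) ⊤ : Set (Fin n → FiniteAdeleRing (𝓞 F) F)) ×ˢ
        tsupport ((f₀ : FinSB F (Fin n)) : (Fin n → FiniteAdeleRing (𝓞 F) F) → ℂ)),
    mul_nonneg (mul_nonneg (mul_nonneg (norm_nonneg _) hK0) hS0) hCb0,
    ((isCompact_piLevelIdeal F (Fin n) ⊤).prod hcs.isCompact).image (by fun_prop), fun g hg => ?_⟩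
  rcases hg with ⟨⟨⟨κ, hκ⟩, hKg⟩, hga, hgp⟩
  have hκK : ‖κ‖ ≤ K := hKg κ hκ
  -- the moved Heisenberg element `η' = π(s g) v̂_a` and the factorisations
  have hη' : (ofSymplectic (polar (adelicForm F (Fin n) T)) (adelicMpCont.proj F (Fin n) T (s g))).act
      (Heisenberg.ofVec (polar (adelicForm F (Fin n) T)) va) ∈ finHeisenberg T :=
    act_mem_finHeisenberg _ hηa
  have e1 := hκ Ψ (Heisenberg.ofVec (polar (adelicForm F (Fin n) T)) va) hηa
  have e0 : adelicMpCont.omega F (Fin n) T (s g) (piSchwartzBruhatEquiv F (Fin n)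
        (Ψ ⊗ₜ[ℂ] finTranslateSB F (Fin n) a (indicatorSB F (Fin n) L hLo hLc))) =
      adelicMpCont.omega F (Fin n) T (s g) (piSchwartzBruhatEquiv F (Fin n)
        (Ψ ⊗ₜ[ℂ] finSchrodinger T (Heisenberg.ofVec (polar (adelicForm F (Fin n) T)) va)
          (indicatorSB F (Fin n) L hLo hLc))) :=
    congrArg (fun φ : FinSB F (Fin n) => adelicMpCont.omega F (Fin n) T (s g)
      (piSchwartzBruhatEquiv F (Fin n) (Ψ ⊗ₜ[ℂ] φ))) hgen
  -- `B (ρ_f(η') 𝟙_L) = ρ_f(π(q) η') f₀`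
  have hBφ : B (finSchrodinger T ((ofSymplectic (polar (adelicForm F (Fin n) T))
        (adelicMpCont.proj F (Fin n) T (s g))).act (Heisenberg.ofVec (polar (adelicForm F (Fin n) T)) va))
        (indicatorSB F (Fin n) L hLo hLc)) =
      finSchrodinger T ((ofSymplectic (polar (adelicForm F (Fin n) T)) (adelicMpCont.proj F (Fin n) T q)).act
        ((ofSymplectic (polar (adelicForm F (Fin n) T)) (adelicMpCont.proj F (Fin n) T (s g))).act
          (Heisenberg.ofVec (polar (adelicForm F (Fin n) T)) va))) f₀ := by
    rw [hf₀]
    exact LinearMap.congr_fun (comp_finSchrodinger_of_finImplementer hB hη') (indicatorSB F (Fin n) L hLo hLc)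
  have e2 := hfac (κ • Winf g Ψ) (finSchrodinger T ((ofSymplectic (polar (adelicForm F (Fin n) T))
        (adelicMpCont.proj F (Fin n) T (s g))).act (Heisenberg.ofVec (polar (adelicForm F (Fin n) T)) va))
        (indicatorSB F (Fin n) L hLo hLc))
  have etot : adelicMpCont.omega F (Fin n) T q (adelicMpCont.omega F (Fin n) T (s g)
        (piSchwartzBruhatEquiv F (Fin n)
          (Ψ ⊗ₜ[ℂ] finTranslateSB F (Fin n) a (indicatorSB F (Fin n) L hLo hLc)))) =
      piSchwartzBruhatEquiv F (Fin n) ((c • Wq (κ • Winf g Ψ)) ⊗ₜ[ℂ]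
        finSchrodinger T ((ofSymplectic (polar (adelicForm F (Fin n) T)) (adelicMpCont.proj F (Fin n) T q)).act
          ((ofSymplectic (polar (adelicForm F (Fin n) T)) (adelicMpCont.proj F (Fin n) T (s g))).act
            (Heisenberg.ofVec (polar (adelicForm F (Fin n) T)) va))) f₀) :=
    ((congrArg (adelicMpCont.omega F (Fin n) T q) (e0.trans e1)).trans e2).trans
      (congrArg (fun φ : FinSB F (Fin n) => piSchwartzBruhatEquiv F (Fin n) ((c • Wq (κ • Winf g Ψ)) ⊗ₜ[ℂ] φ))
        hBφ)
  -- the finite position of the doubly moved element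
  have hpos : piFinite F (Fin n) ((ofSymplectic (polar (adelicForm F (Fin n) T)) (adelicMpCont.proj F (Fin n) T q)).act
        ((ofSymplectic (polar (adelicForm F (Fin n) T)) (adelicMpCont.proj F (Fin n) T (s g))).act
          (Heisenberg.ofVec (polar (adelicForm F (Fin n) T)) va))).v.1 =
      piFinite F (Fin n)
        (((adelicMpCont.proj F (Fin n) T q : symplecticGroup (polar (adelicForm F (Fin n) T))) :
          ((Fin n → AdeleRing (𝓞 F) F) × (Fin n → AdeleRing (𝓞 F) F)) ≃ₗ[AdeleRing (𝓞 F) F]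
            ((Fin n → AdeleRing (𝓞 F) F) × (Fin n → AdeleRing (𝓞 F) F)))
          (((adelicMpCont.proj F (Fin n) T (s g) : symplecticGroup (polar (adelicForm F (Fin n) T))) :
            ((Fin n → AdeleRing (𝓞 F) F) × (Fin n → AdeleRing (𝓞 F) F)) ≃ₗ[AdeleRing (𝓞 F) F]
              ((Fin n → AdeleRing (𝓞 F) F) × (Fin n → AdeleRing (𝓞 F) F))) va)).1 :=
    congrArg (fun w : (Fin n → AdeleRing (𝓞 F) F) × (Fin n → AdeleRing (𝓞 F) F) => piFinite F (Fin n) w.1)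
      ((Heisenberg.PseudoSymplectic.act_v _ _).trans (congrArg _ (act_ofVec_v _ va)))
  have hvb := fun x => value_bounds_tmul (c • Wq (κ • Winf g Ψ)) _ f₀ hCb etot x
  refine ⟨fun x => (hvb x).1.trans ?_, fun x hx => (hvb x).2 ?_⟩
  · -- value bound
    have hval : (c • Wq (κ • Winf g Ψ)) (piArch F (Fin n) x) = c * (κ * Wq (Winf g Ψ) (piArch F (Fin n) x)) := by
      rw [smul_apply, map_smul, smul_apply, smul_eq_mul, smul_eq_mul]
    rw [hval, norm_mul, norm_mul]
    have h1 : ‖Wq (Winf g Ψ) (piArch F (Fin n) x)‖ ≤ S * (1 + ‖vecInfinitePart F n x‖) ^ (-(k : ℝ)) := hS g hga _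
    have h3 : 0 ≤ (1 + ‖vecInfinitePart F n x‖) ^ (-(k : ℝ)) := Real.rpow_nonneg (by positivity) _
    calc ‖c‖ * (‖κ‖ * ‖Wq (Winf g Ψ) (piArch F (Fin n) x)‖) * Cb
        ≤ ‖c‖ * (K * (S * (1 + ‖vecInfinitePart F n x‖) ^ (-(k : ℝ)))) * Cb :=
          mul_le_mul_of_nonneg_right
            (mul_le_mul_of_nonneg_left (mul_le_mul hκK h1 (norm_nonneg _) hK0) (norm_nonneg _)) hCb0
      _ = ‖c‖ * K * S * Cb * (1 + ‖vecInfinitePart F n x‖) ^ (-(k : ℝ)) := by ring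
  · -- support
    rw [hpos]
    intro hmem
    apply hx
    refine ⟨(-c₀ + piFinite F (Fin n)
      (((adelicMpCont.proj F (Fin n) T q : symplecticGroup (polar (adelicForm F (Fin n) T))) :
        ((Fin n → AdeleRing (𝓞 F) F) × (Fin n → AdeleRing (𝓞 F) F)) ≃ₗ[AdeleRing (𝓞 F) F]
          ((Fin n → AdeleRing (𝓞 F) F) × (Fin n → AdeleRing (𝓞 F) F)))
        (((adelicMpCont.proj F (Fin n) T (s g) : symplecticGroup (polar (adelicForm F (Fin n) T))) :
          ((Fin n → AdeleRing (𝓞 F) F) × (Fin n → AdeleRing (𝓞 F) F)) ≃ₗ[AdeleRing (𝓞 F) F]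
            ((Fin n → AdeleRing (𝓞 F) F) × (Fin n → AdeleRing (𝓞 F) F))) va)).1, _), ⟨hgp, hmem⟩, ?_⟩
    show -(c₀ + (-c₀ + _)) + (_ + piFinite F (Fin n) x) = vecFinitePart F n x
    rw [add_neg_cancel_left, neg_add_cancel_left]
    rfl

set_option maxHeartbeats 400000 in
include hT hsm hs w0 w1 w2 hWq0 hWq in
/-- **Locally uniform decay of `ω(q)ω(s h)Φ` near `1`** for every `Φ ∈ 𝒮(𝔸_Fⁿ)`: reduce to the generators
(★ `exists_level_of_mem_schwartzBruhat`, ★ `exists_eq_sum_smul_finTranslateSB_indicatorSB`) and combine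
(`decay_generator_conj`, ★ `decay_sum`, `decay_smul`, `decay_add`). [cite: Weil1964, Chap. III n° 41, Lemme 5 p. 194] -/
theorem decay_near_one_conj (Φ : piSchwartzBruhat F (Fin n)) (k : ℕ) :
    ∃ V ∈ 𝓝 (1 : H), ∃ (M : ℝ) (Cf : Set (Fin n → FiniteAdeleRing (𝓞 F) F)), 0 ≤ M ∧ IsCompact Cf ∧
      ∀ g ∈ V,
        (∀ x, ‖((adelicMpCont.omega F (Fin n) T q (adelicMpCont.omega F (Fin n) T (s g) Φ) :
          piSchwartzBruhat F (Fin n)) : (Fin n → AdeleRing (𝓞 F) F) → ℂ) x‖ ≤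
            M * (1 + ‖vecInfinitePart F n x‖) ^ (-(k : ℝ))) ∧
        (∀ x, vecFinitePart F n x ∉ Cf →
            ((adelicMpCont.omega F (Fin n) T q (adelicMpCont.omega F (Fin n) T (s g) Φ) :
              piSchwartzBruhat F (Fin n)) : (Fin n → AdeleRing (𝓞 F) F) → ℂ) x = 0) := by
  obtain ⟨Φ, hΦ⟩ := Φ
  induction hΦ using Submodule.span_induction with
  | mem Φ hfac =>
    obtain ⟨Ψ, Φf, hfin, rfl⟩ := hfac
    have hexl := exists_level_of_mem_schwartzBruhat F hfin
    rcases hexl with ⟨𝔫, -, hlev⟩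
    have hext := exists_eq_sum_smul_finTranslateSB_indicatorSB (piLevelIdeal F (Fin n) 𝔫)
      (isOpen_piLevelIdeal F 𝔫) (isCompact_piLevelIdeal F (Fin n) 𝔫) (⟨Φf, hfin⟩ : FinSB F (Fin n)) hlev
    rcases hext with ⟨t, ht⟩
    have hgen : (⟨_, Submodule.subset_span ⟨Ψ, Φf, hfin, rfl⟩⟩ : piSchwartzBruhat F (Fin n)) =
        ∑ p ∈ t, ((⟨Φf, hfin⟩ : FinSB F (Fin n)) : (Fin n → FiniteAdeleRing (𝓞 F) F) → ℂ) p.out •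
          piSchwartzBruhatEquiv F (Fin n) (Ψ ⊗ₜ[ℂ]
            finTranslateSB F (Fin n) (-(p.out : Fin n → FiniteAdeleRing (𝓞 F) F))
              (indicatorSB F (Fin n) (piLevelIdeal F (Fin n) 𝔫) (isOpen_piLevelIdeal F 𝔫)
                (isCompact_piLevelIdeal F (Fin n) 𝔫))) := by
      have e1 : (⟨_, Submodule.subset_span ⟨Ψ, Φf, hfin, rfl⟩⟩ : piSchwartzBruhat F (Fin n)) =
          piSchwartzBruhatEquiv F (Fin n) (Ψ ⊗ₜ[ℂ] (⟨Φf, hfin⟩ : FinSB F (Fin n))) := by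
        apply Subtype.ext
        rw [coe_piSchwartzBruhatEquiv_tmul]
      conv_lhs => rw [e1, ht, TensorProduct.tmul_sum, map_sum]
      refine Finset.sum_congr rfl fun p _ => ?_
      rw [TensorProduct.tmul_smul, map_smul]
    refine decay_congr (f₁ := fun g => ∑ p ∈ t,
      ((⟨Φf, hfin⟩ : FinSB F (Fin n)) : (Fin n → FiniteAdeleRing (𝓞 F) F) → ℂ) p.out •
        adelicMpCont.omega F (Fin n) T q (adelicMpCont.omega F (Fin n) T (s g)
          (piSchwartzBruhatEquiv F (Fin n) (Ψ ⊗ₜ[ℂ]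
            finTranslateSB F (Fin n) (-(p.out : Fin n → FiniteAdeleRing (𝓞 F) F))
              (indicatorSB F (Fin n) (piLevelIdeal F (Fin n) 𝔫) (isOpen_piLevelIdeal F 𝔫)
                (isCompact_piLevelIdeal F (Fin n) 𝔫))))))
      (fun g x => congrArg (fun Φ' : piSchwartzBruhat F (Fin n) => (Φ' : (Fin n → AdeleRing (𝓞 F) F) → ℂ) x)
        ((congrArg (fun Φ' : piSchwartzBruhat F (Fin n) =>
            adelicMpCont.omega F (Fin n) T q (adelicMpCont.omega F (Fin n) T (s g) Φ')) hgen).trans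
          (((congrArg (adelicMpCont.omega F (Fin n) T q)
              (map_sum (adelicMpCont.omega F (Fin n) T (s g)) _ t)).trans
            (map_sum (adelicMpCont.omega F (Fin n) T q) _ t)).trans
            (Finset.sum_congr rfl fun p _ =>
              (congrArg (adelicMpCont.omega F (Fin n) T q)
                (map_smul (adelicMpCont.omega F (Fin n) T (s g)) _ _)).trans
                (map_smul (adelicMpCont.omega F (Fin n) T q) _ _))))) ?_
    exact decay_sum t _ fun p _ => decay_smul _
      (decay_generator_conj hT s hsm hs Winf w0 w1 w2 q Wq hWq0 hWq _ _ _ Ψ _ k)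
  | zero =>
    exact decay_congr (f₁ := fun _ => (0 : piSchwartzBruhat F (Fin n)))
      (fun g x => congrArg (fun Φ' : piSchwartzBruhat F (Fin n) => (Φ' : (Fin n → AdeleRing (𝓞 F) F) → ℂ) x)
        (((congrArg (adelicMpCont.omega F (Fin n) T q) (map_zero (adelicMpCont.omega F (Fin n) T (s g)))).trans
          (map_zero _)))) decay_zero
  | add Φ Ψ hΦ hΨ ihΦ ihΨ =>
    exact decay_congr
      (f₁ := fun g => adelicMpCont.omega F (Fin n) T q (adelicMpCont.omega F (Fin n) T (s g) ⟨Φ, hΦ⟩) +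
        adelicMpCont.omega F (Fin n) T q (adelicMpCont.omega F (Fin n) T (s g) ⟨Ψ, hΨ⟩))
      (fun g x => congrArg (fun Φ' : piSchwartzBruhat F (Fin n) => (Φ' : (Fin n → AdeleRing (𝓞 F) F) → ℂ) x)
        (((congrArg (adelicMpCont.omega F (Fin n) T q)
          (map_add (adelicMpCont.omega F (Fin n) T (s g)) ⟨Φ, hΦ⟩ ⟨Ψ, hΨ⟩)).trans (map_add _ _ _))))
      (decay_add ihΦ ihΨ)
  | smul c Φ hΦ ih =>
    exact decay_congr
      (f₁ := fun g => c • adelicMpCont.omega F (Fin n) T q (adelicMpCont.omega F (Fin n) T (s g) ⟨Φ, hΦ⟩))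
      (fun g x => congrArg (fun Φ' : piSchwartzBruhat F (Fin n) => (Φ' : (Fin n → AdeleRing (𝓞 F) F) → ℂ) x)
        (((congrArg (adelicMpCont.omega F (Fin n) T q)
          (map_smul (adelicMpCont.omega F (Fin n) T (s g)) c ⟨Φ, hΦ⟩)).trans (map_smul _ _ _))))
      (decay_smul c ih)

include hT hsm hs w0 w1 w2 hWq0 hWq in
/-- **Locally uniform decay of `ω(q)ω(s h)Φ` near any `h₀`**, by translating `decay_near_one_conj` with
`ω(s h)Φ = ω(s(h h₀⁻¹))(ω(s h₀)Φ)`. [cite: Weil1964, Chap. III n° 41, Lemme 5 p. 194] -/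
theorem decay_near_conj (Φ : piSchwartzBruhat F (Fin n)) (k : ℕ) (h₀ : H) :
    ∃ V ∈ 𝓝 (h₀), ∃ (M : ℝ) (Cf : Set (Fin n → FiniteAdeleRing (𝓞 F) F)), 0 ≤ M ∧ IsCompact Cf ∧
      ∀ g ∈ V,
        (∀ x, ‖((adelicMpCont.omega F (Fin n) T q (adelicMpCont.omega F (Fin n) T (s g) Φ) :
          piSchwartzBruhat F (Fin n)) : (Fin n → AdeleRing (𝓞 F) F) → ℂ) x‖ ≤
            M * (1 + ‖vecInfinitePart F n x‖) ^ (-(k : ℝ))) ∧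
        (∀ x, vecFinitePart F n x ∉ Cf →
            ((adelicMpCont.omega F (Fin n) T q (adelicMpCont.omega F (Fin n) T (s g) Φ) :
              piSchwartzBruhat F (Fin n)) : (Fin n → AdeleRing (𝓞 F) F) → ℂ) x = 0) := by
  have e : ∀ g : H, s g = s (g * h₀⁻¹) * s h₀ := fun g => by rw [← hsm, inv_mul_cancel_right]
  have heq : ∀ g : H, adelicMpCont.omega F (Fin n) T (s g) Φ =
      adelicMpCont.omega F (Fin n) T (s (g * h₀⁻¹)) (adelicMpCont.omega F (Fin n) T (s h₀) Φ) := fun g =>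
    LinearMap.congr_fun ((congrArg (fun p => adelicMpCont.omega F (Fin n) T p) (e g)).trans
      (map_mul (adelicMpCont.omega F (Fin n) T) _ _)) Φ
  exact decay_congr (f₁ := fun g => adelicMpCont.omega F (Fin n) T q
      (adelicMpCont.omega F (Fin n) T (s (g * h₀⁻¹)) (adelicMpCont.omega F (Fin n) T (s h₀) Φ)))
    (fun g x => congrArg (fun Φ' : piSchwartzBruhat F (Fin n) => (Φ' : (Fin n → AdeleRing (𝓞 F) F) → ℂ) x)
      (congrArg (adelicMpCont.omega F (Fin n) T q) (heq g)))
    (decay_comp (f₁ := fun g => adelicMpCont.omega F (Fin n) T q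
        (adelicMpCont.omega F (Fin n) T (s g) (adelicMpCont.omega F (Fin n) T (s h₀) Φ)))
      (fun h : H => h * h₀⁻¹) (continuous_id.mul continuous_const).continuousAt (mul_inv_cancel h₀)
      (decay_near_one_conj hT s hsm hs Winf w0 w1 w2 q Wq hWq0 hWq (adelicMpCont.omega F (Fin n) T (s h₀) Φ) k))

end Decay

end Literature.NumberTheory.Weil1964

end
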